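import Summits.ResolutionOfSingularities.ResolutionOfSingularities.Theorems.WildQuotientsSummitReductionStubPairOrbitBlowupCentreLocalLemmas
import Mathlib.RingTheory.LocalRing.ResidueField.Fiber
import Mathlib.RingTheory.Localization.BaseChange
import Mathlib.RingTheory.Localization.LocalizationLocalization
import HarnessLib

/-!
# `WildQuotients.SummitReduction` (stmt-ResolutionOfSingularities-16324), line `FramePerfect`:
# the local rings of the base-changed fibre ring at primes over a point, as local rings of the
# base change of the fibre LOCAL ring (algebra of stub `stub_pair_orbitBlowupCentreLocal`, file 14)

Route `ResolutionOfSingularities/WildQuotients`, crux `SummitReduction`; helper file of stub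
`stub_pair_orbitBlowupCentreLocal` (C2: de Jong 1996, 3.4 Claim (ii) over the orbit centre). For
clause (H4) off the chart origins, smoothness of `R → S` at `q` is reduced (file 13) to regularity
of the local rings of `l₀ ⊗_l F`, `F = κ(p) ⊗_R S` the fibre ring, `l = κ(p)`, at the primes `x'`
over the prime `q'` of `F` over `q`, while the engine (file 9) controls the local rings of
`l₀ ⊗_l B` at primes over `𝔪_B` for the fibre LOCAL ring `B = S_q/𝔪_p S_q`. This file PROVES the
bookkeeping between the two (`exists_prime_baseChange_fibreQuot_equiv`): `B ≅ F_{q'}` over `l`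
(Mathlib's `Ideal.Fiber.localizationAlgEquivQuotient`), `l₀ ⊗_l F_{q'}` is the localization of
`l₀ ⊗_l F` at the image of `F ∖ q'` (base change commutes with localization), and `x'` misses that
image, so `(l₀ ⊗_l F)_{x'}` is the local ring of `l₀ ⊗_l B` at a prime `𝔑` over `𝔪_B`.
-/

set_option linter.dupNamespace false

noncomputable section

open IsLocalRing TensorProduct
open Literature.AlgebraicGeometry.Resolution

namespace Summit.ResolutionOfSingularities.ResolutionOfSingularities.Theorems

universe u

section Bookkeeping

variable {R S : Type u} [CommRing R] [CommRing S] [Algebra R S]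
  (p : Ideal R) [p.IsPrime] (q' : Ideal (p.Fiber S)) [q'.IsPrime]
  (q : Ideal S) [q.IsPrime]
  (hq : q = q'.comap (Algebra.TensorProduct.includeRight : S →ₐ[R] p.Fiber S))
  (hpq : p = q.comap (algebraMap R S))

include hq in
/-- **The fibre local ring `B = S_q/𝔪_p S_q` is the local ring `F_{q'}` of the fibre ring
`F = κ(p) ⊗_R S` at the prime `q'` over `q`, over `κ(p)`** (Mathlib's
`Ideal.Fiber.localizationAlgEquivQuotient`, an `R_p`-algebra isomorphism, read over `κ(p)` for any
`κ(p)`-structure on `B` through which `R_p` acts). [folklore] -/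
theorem nonempty_algEquiv_localization_fiber_fibreQuot
    [Algebra p.ResidueField (Localization.AtPrime q ⧸ (maximalIdeal (Localization.AtPrime p)).map
      (Localization.localRingHom p q (algebraMap R S) hpq))]
    (hlB : ∀ a : Localization.AtPrime p, algebraMap p.ResidueField
      (Localization.AtPrime q ⧸ (maximalIdeal (Localization.AtPrime p)).map
        (Localization.localRingHom p q (algebraMap R S) hpq)) (residue _ a) =
      Ideal.Quotient.mk _ (Localization.localRingHom p q (algebraMap R S) hpq a)) :
    Nonempty (Localization.AtPrime q' ≃ₐ[p.ResidueField]
        (Localization.AtPrime q ⧸ (maximalIdeal (Localization.AtPrime p)).map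
          (Localization.localRingHom p q (algebraMap R S) hpq))) := by
  subst hq
  haveI : (q'.comap (Algebra.TensorProduct.includeRight : S →ₐ[R] p.Fiber S)).LiesOver p := ⟨hpq⟩
  letI := Localization.AtPrime.algebraOfLiesOver p
    (q'.comap (Algebra.TensorProduct.includeRight : S →ₐ[R] p.Fiber S))
  let Rp := Localization.AtPrime p
  let Sq := Localization.AtPrime (q'.comap (Algebra.TensorProduct.includeRight : S →ₐ[R] p.Fiber S))
  have hψ : algebraMap Rp Sq = Localization.localRingHom p _ (algebraMap R S) hpq := rfl
  -- Mathlib's isomorphism over `R_p`, followed by the equality of ideals `p S_q = 𝔪_p S_q`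
  let e₁ : Localization.AtPrime q' ≃ₐ[Rp] Sq ⧸ p.map (algebraMap R Sq) :=
    Ideal.Fiber.localizationAlgEquivQuotient p q'
  have hmap : p.map (algebraMap R Sq) = (maximalIdeal Rp).map
      (Localization.localRingHom p _ (algebraMap R S) hpq) := by
    rw [← hψ, ← Localization.AtPrime.map_eq_maximalIdeal, Ideal.map_map, ← IsScalarTower.algebraMap_eq]
  let e₂ : (Sq ⧸ p.map (algebraMap R Sq)) ≃ₐ[Rp] Sq ⧸ (maximalIdeal Rp).map
      (Localization.localRingHom p _ (algebraMap R S) hpq) :=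
    Ideal.quotientEquivAlgOfEq Rp hmap
  let E := e₁.trans e₂
  -- `E` is `κ(p)`-linear
  have hE1 : ∀ c : p.ResidueField, E (algebraMap p.ResidueField _ c) = algebraMap p.ResidueField _ c := by
    intro c
    obtain ⟨r, rfl⟩ := IsLocalRing.residue_surjective c
    have h1 : algebraMap p.ResidueField (Localization.AtPrime q') (residue Rp r) =
        algebraMap Rp (Localization.AtPrime q') r :=
      (IsScalarTower.algebraMap_apply Rp p.ResidueField (Localization.AtPrime q') r).symm
    rw [h1, AlgEquiv.commutes, hlB, IsScalarTower.algebraMap_apply Rp Sq (Sq ⧸ _) r,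
      Ideal.Quotient.algebraMap_eq, hψ]
  exact ⟨{ E.toRingEquiv with commutes' := hE1 }⟩

/-- **The local rings of `l₀ ⊗_κ F` at the primes over `q'` are local rings of `l₀ ⊗_κ B` at
primes over `𝔪_B`**, for a `κ`-algebra `F`, a prime `q'` and any local `κ`-algebra `B ≅ F_{q'}` over
`κ` (e.g. the fibre ring `F = κ(p) ⊗_R S` and `B = S_q/𝔪_p S_q`,
`nonempty_algEquiv_localization_fiber_fibreQuot`): `l₀ ⊗ F_{q'}` is the localization of `l₀ ⊗ F`
at the image of `F ∖ q'` (Mathlib's `IsLocalization.tensorProductEquivOfMapIncludeRight`), which a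
prime `x'` over `q'` misses, so `(l₀ ⊗ F)_{x'}` is the localization of `l₀ ⊗ B` at the
corresponding prime `𝔑`, and `𝔑 ∩ B ⊇ 𝔪_B` since `x' ∩ F ⊇ q'`. [folklore] -/
theorem exists_prime_baseChange_localization_equiv {κ : Type u} [Field κ] {F : Type u} [CommRing F]
    [Algebra κ F] (q' : Ideal F) [q'.IsPrime] {B : Type u} [CommRing B] [IsLocalRing B]
    [Algebra κ B] (eB : Localization.AtPrime q' ≃ₐ[κ] B)
    (l₀ : Type u) [Field l₀] [Algebra κ l₀] (x' : Ideal (l₀ ⊗[κ] F)) [x'.IsPrime]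
    (hx' : x'.comap (Algebra.TensorProduct.includeRight (R := κ) (A := l₀) :
      F →ₐ[κ] l₀ ⊗[κ] F).toRingHom = q') :
    ∃ (𝔑 : Ideal (l₀ ⊗[κ] B)) (_ : 𝔑.IsPrime),
      (maximalIdeal B).map (tensorInr κ l₀ B) ≤ 𝔑 ∧
      Nonempty (Localization.AtPrime x' ≃+* Localization.AtPrime 𝔑) := by
  -- `l₀ ⊗ F_{q'} ≅ (l₀ ⊗ F)_M`, `M` the image of `F ∖ q'`
  obtain ⟨eloc, heloc⟩ : ∃ e : l₀ ⊗[κ] Localization.AtPrime q' ≃ₐ[l₀]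
      Localization (q'.primeCompl.map (Algebra.TensorProduct.includeRight (R := κ)
        (A := l₀) (B := F))),
      ∀ (x : l₀) (s : F), e (x ⊗ₜ algebraMap F (Localization.AtPrime q') s) = algebraMap _ _ (x ⊗ₜ s) :=
    ⟨IsLocalization.tensorProductEquivOfMapIncludeRight κ l₀ q'.primeCompl
        (Localization.AtPrime q') _,
      fun x s => IsLocalization.tensorProductEquivOfMapIncludeRight_tmul (R := κ) (S := l₀)
        F q'.primeCompl (Localization.AtPrime q') _ x s⟩
  let Θ := (Algebra.TensorProduct.congr (AlgEquiv.refl : l₀ ≃ₐ[l₀] l₀) eB.symm).trans eloc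
  have hΘ : ∀ z : Localization.AtPrime q', Θ ((1 : l₀) ⊗ₜ eB z) = eloc ((1 : l₀) ⊗ₜ z) := fun z => by
    simp only [Θ, AlgEquiv.trans_apply, Algebra.TensorProduct.congr_apply, AlgEquiv.refl_toAlgHom,
      Algebra.TensorProduct.map_tmul, AlgHom.coe_id, id_eq]
    exact congrArg (fun w => eloc ((1 : l₀) ⊗ₜ w)) (eB.symm_apply_apply z)
  -- `x'` misses `M`; its extension `x'ₘ`
  have hdisj : Disjoint ((q'.primeCompl.map (Algebra.TensorProduct.includeRight (R := κ)
      (A := l₀) (B := F)) : Submonoid (l₀ ⊗[κ] F)) : Set (l₀ ⊗[κ] F)) x' := by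
    rw [Set.disjoint_left]
    rintro z ⟨s, hs, rfl⟩ hz
    apply hs
    change s ∈ q'
    rw [← hx']
    exact hz
  obtain ⟨xM, hxM⟩ : ∃ I : Ideal (Localization (q'.primeCompl.map (Algebra.TensorProduct.includeRight
      (R := κ) (A := l₀) (B := F)))), I = x'.map (algebraMap _ _) := ⟨_, rfl⟩
  haveI hxMp : xM.IsPrime := by
    rw [hxM]; exact IsLocalization.isPrime_of_isPrime_disjoint _ _ x' ‹_› hdisj
  have hcomap : xM.comap (algebraMap _ _) = x' := by
    rw [hxM]; exact IsLocalization.under_map_of_isPrime_disjoint _ _ ‹_› hdisj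
  -- `(l₀ ⊗ F)_{x'} ≅ ((l₀ ⊗ F)_M)_{x'ₘ} ≅ (l₀ ⊗ B)_𝔑` (`x' = x'ₘ ∩ (l₀ ⊗ F)`)
  subst hcomap
  let ρ₁ : Localization.AtPrime (xM.comap (algebraMap (l₀ ⊗[κ] F) _)) ≃+* Localization.AtPrime xM :=
    (IsLocalization.algEquiv (xM.comap (algebraMap (l₀ ⊗[κ] F) _)).primeCompl
      (Localization.AtPrime (xM.comap (algebraMap (l₀ ⊗[κ] F) _))) (Localization.AtPrime xM)).toRingEquiv
  obtain ⟨ρ₂, -⟩ := exists_localization_ringEquiv_of_ringEquiv Θ.toRingEquiv xM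
  refine ⟨xM.comap Θ.toRingEquiv.toRingHom, Ideal.comap_isPrime _ _, ?_, ⟨ρ₁.trans ρ₂⟩⟩
  -- `𝔪_B (l₀ ⊗ B) ⊆ 𝔑`: `𝔪_B = eB (q' F_{q'})`
  rw [Ideal.map_le_iff_le_comap]
  have hmB : maximalIdeal B = (q'.map (algebraMap F (Localization.AtPrime q'))).map
      eB.toRingEquiv.toRingHom := by
    rw [Localization.AtPrime.map_eq_maximalIdeal]
    exact (IsLocalRing.eq_maximalIdeal (Ideal.map_isMaximal_of_equiv eB.toRingEquiv
      (p := maximalIdeal (Localization.AtPrime q')))).symm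
  rw [hmB, Ideal.map_le_iff_le_comap, Ideal.map_le_iff_le_comap]
  intro s hs
  rw [Ideal.mem_comap, Ideal.mem_comap, Ideal.mem_comap, tensorInr_apply, Ideal.mem_comap]
  change Θ ((1 : l₀) ⊗ₜ eB (algebraMap F (Localization.AtPrime q') s)) ∈ xM
  rw [hΘ, heloc, hxM]
  exact Ideal.mem_map_of_mem _ (by rw [← hx'] at hs; exact hs)

end Bookkeeping

end Summit.ResolutionOfSingularities.ResolutionOfSingularities.Theorems

end
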